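import Summits.BirchSwinnertonDyer.BirchSwinnertonDyer.Theorems.KatoDescentTamePotSupersingularJetchevIrreducibleReadingThm52Bricks
import Summits.BirchSwinnertonDyer.BirchSwinnertonDyer.Theorems.Rank1ResidualJetKolyvaginClassOrder
import Summits.BirchSwinnertonDyer.BirchSwinnertonDyer.Theorems.Rank1ResidualJetKolyvaginClassSign
import Summits.BirchSwinnertonDyer.BirchSwinnertonDyer.Theorems.Rank1ResidualJetKolyvaginClassLocal
import Summits.BirchSwinnertonDyer.Rank1Residual.X11b.RingClassFieldNoTorsionOfIrreducible
import Summits.BirchSwinnertonDyer.Rank1Residual.X11b.SplitPrimeUnramified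
import Summits.BirchSwinnertonDyer.Rank1Residual.JET.GrossProp53Kolyvagin
import Literature.NumberTheory.EllipticCurves.WeilPairingProofs
import Literature.NumberTheory.EllipticCurves.HeegnerPointsOfConductorRationalityProofs
import Literature.NumberTheory.EllipticCurves.RingClassGalOverCyclicProofs
import HarnessLib

/-!
# Route `PrintX9`, crux J = `HeegnerDivisibilityX9` (item 20392), stub `stub_jetchevX9`: the three
# image-dependent BRICKS of the Jetchev Thm. 5.2 kernel line at a prime `p` SPLIT in the Heegner field
# with `E[p]` IRREDUCIBLE (no hypothesis on the reduction of `E` at `p`)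

Cell `bsd-print-x9` (print tier, key `x9`), prover seat p4; `--supports stmt-BirchSwinnertonDyer-20392`,
helper; THEOREMS ONLY, nothing booked, no item closed, BSD is not proved by any of this.

WHAT. Cell `bsd-potss` (seat k8t-c4 g8, `KatoDescentTamePotSupersingularJetchevIrreducibleReadingThm52Bricks`)
re-ran the three row-level bricks of bsd-jet's H63 assembly (`JET.tamagawaExponent_le_mInfty_of_kernelInputs`)
— S7 (`hordκ`/`hκ0`: a datum with `p^{m_∞} ∥ P_c` and `ord c_k(c) = p^{k−m_∞}`), the sign `hκsign` (in k9-c4 g9's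
UNCONDITIONAL form `…ReadingSignUnconditional`: Gross Prop. 5.3 at the divisors of `c` is the tree theorem
`JET.exists_mem_ringClassGal_isOfFinAddOrder_conj_sub_smul`) and the Kummer part of `hκsel` (mod [GZ86 III (3.1)]) — with the mod-`p` SURJECTIVITY replaced by
`E[p]` irreducible + `p ∣ N_E`. The ONLY use of `p ∣ N_E` there is «`p` is unramified in `K`» (a Heegner prime
splits), feeding x11b3's admissibility theorem
`X11b.NoTorsionIrr.isAdmissible_pointsSubgroup_of_hasIrreducibleModPGaloisRep_of_dvd` (Gross Lemma 4.3 = no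
`p`-torsion over the ring class fields, from irreducibility + the Weil pairing + `p` unramified in `K` + `p ∤ c`).
On the X9 frames of crux J (`Rank1Residual.ClassX9 W p`: good ordinary `p ≥ 5`, `E[p]` irreducible, `ρ̄_{E,p}`
not onto; `K` Heegner for `N_E` with `p` SPLIT) `p ∤ N_E`, but `p` split is unramified just the same
(`X11b.isUnramifiedIn_of_satisfiesHeegnerHypothesis_of_dvd` at the level `p`). This file is the three bricks
with `(hpN : p ∣ N_E)` replaced by `(hHp : SatisfiesHeegnerHypothesis p K)` (`p` split in `K`); statements and
proofs are the bsd-potss ones byte-for-byte up to that binder and the admissibility term. Generic in the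
reduction type at `p` (the potss rows `p ∣ N_E` are the special case `hHp := hH.of_dvd hpN`).

References: [cite: GrossLMS1991, §3 (pp. 238–239), Prop. 3.6, Lemma 4.3, §5 Prop. 5.3–5.4, §6 Prop. 6.2 (1)]
[cite: McCallumLMS1991, §4 (4)–(6), §5 (p. 305)] [cite: GrossZagier1986, III (3.1)] [cite: Jetchev2008, §4.1.4,
Prop. 4.6, proof of Thm. 5.2 (p. 822), Rem. 6.2] [cite: Cox2013, §9.A].
-/

set_option autoImplicit false

noncomputable section

open scoped Classical
open WeierstrassCurve Field NumberField IsDedekindDomain Finset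
open Literature.NumberTheory.EllipticCurves Literature.NumberTheory.GaloisRepresentations
open Literature.NumberTheory.EllipticCurves.KolyvaginCocycle Literature.NumberTheory.EllipticCurves.KolyvaginEuler
open Literature.NumberTheory.EllipticCurves.RingClassField Literature.NumberTheory.EllipticCurves.ModularForms
open Summit.BirchSwinnertonDyer.Rank1Residual.X11b Summit.BirchSwinnertonDyer.Rank1Residual.X11b.Three
open Summit.BirchSwinnertonDyer.Rank1Residual.X11b.Three.GrossBadPlace
open Summit.BirchSwinnertonDyer.Rank1Residual.X11b.KolyvaginHloc
open Summit.BirchSwinnertonDyer.Rank1Residual.JET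
open Summit.BirchSwinnertonDyer.BirchSwinnertonDyer.Theorems

namespace Summit.BirchSwinnertonDyer.Rank1Residual.JET.Split

-- `K : Type`: the tree's ring-class class field theory is universe `0`.
variable {K : Type} [Field K] [NumberField K] {W : WeierstrassCurve ℚ}

/-! ### §0 The admissibility on an irreducible row -/

/-- **Admissibility of `E(K[m]) ⊆ E(K̄)` modulo `p^k` at every divisor `m` of a Kolyvagin conductor `c`, for
`E[p]` IRREDUCIBLE and `p` SPLIT in `K`** (Gross Lemma 4.3 without surjectivity): x11b3's
`isAdmissible_pointsSubgroup_of_hasIrreducibleModPGaloisRep_of_dvd` fed with the PROVED Weil pairing, the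
unramifiedness of `p` in `K` (`p` split, `SatisfiesHeegnerHypothesis p K`), and `p ∤ c`.
[cite: GrossLMS1991, §4, Lemma 4.3] [cite: McCallumLMS1991, §4 (5)] [cite: Cox2013, §9.A] -/
theorem isAdmissible_of_irreducible_of_split [W.IsElliptic] [W.IsGloballyMinimal]
    [NeZero (W.conductorNorm ℤ)] (hK : IsImaginaryQuadratic K)
    {p : ℕ} (hp : p.Prime) (hp2 : p ≠ 2) (hirr : W.HasIrreducibleModPGaloisRep p)
    (hHp : SatisfiesHeegnerHypothesis p K)
    {Dt : ModularParametrizationData W (W.conductorNorm ℤ)} {β : ℤ} {ι : K →+* ℂ}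
    {c : ℕ} (hc : Squarefree c) {k : ℕ}
    (hcK : ∀ ℓ ∈ c.primeFactors, Zhang2014.IsKolyvaginPrime (W.conductorNorm ℤ) W K p ℓ ∧
      k ≤ Zhang2014.kolyvaginIndex W p ℓ)
    (data : (m : ℕ) → m ∣ c → KolyvaginHeegnerData Dt β ι m) (m : ℕ) (hm : m ∣ c) :
    IsAdmissible (absoluteGaloisGroup K) (data m hm).pointsSubgroup ((p ^ k : ℕ) : ℤ) :=
  NoTorsionIrr.isAdmissible_pointsSubgroup_of_hasIrreducibleModPGaloisRep_of_dvd hK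
    hc.ne_zero data hp hp2 hirr (W.exists_weilPairing_holds p)
    (isUnramifiedIn_of_satisfiesHeegnerHypothesis_of_dvd hK hHp hp (dvd_refl p))
    (JetchevIrreducibleReadingThm52Bricks.not_dvd_of_primeFactors_isKolyvaginPrime hp hc.ne_zero hcK) k m hm

/-! ### §1 S7 (`hordκ`, `hκ0`) on an irreducible row -/

/-- **A datum with `p^{m_∞} ∥ P_c`, `ord c_k(c) = p^{k − m_∞}`, `c_k(c) ≠ 0`, for `E[p]` IRREDUCIBLE, `p` SPLIT in `K`**:
bsd-jet's `JET.exists_datum_addOrderOf_kolyvaginClass_of_m_eq` with the admissibility from irreducibility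
(`isAdmissible_of_irreducible_of_split`) instead of mod-`p` surjectivity; modulo the two Gross §3 CM
facts making data exist at the divisors (`hCM1`, `hCM2`). [cite: McCallumLMS1991, §5, proof of Prop. 5.2 (p. 305)]
[cite: GrossLMS1991, §3 (pp. 238–239), Prop. 3.6, Lemma 4.3] [cite: Jetchev2008, §4.1.4 (p. 818)] -/
theorem exists_datum_addOrderOf_kolyvaginClass_of_m_eq_of_irreducible_of_split [W.IsElliptic] [W.IsGloballyMinimal]
    [NeZero (W.conductorNorm ℤ)]
    (hCM1 : phi_heegnerPointOfConductor_mem_range_map_ringClassField (W.conductorNorm ℤ) W K)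
    (hCM2 : exists_generator_ringClassGalOver K)
    (hK : IsImaginaryQuadratic K) (hD3 : NumberField.discr K ≠ -3) (hD4 : NumberField.discr K ≠ -4)
    (hH : SatisfiesHeegnerHypothesis (W.conductorNorm ℤ) K)
    {p : ℕ} [Fact p.Prime] (hp2 : p ≠ 2) (hirr : W.HasIrreducibleModPGaloisRep p)
    (hHp : SatisfiesHeegnerHypothesis p K)
    (Dt : ModularParametrizationData W (W.conductorNorm ℤ)) (β : ℤ) (ι : K →+* ℂ)
    (mdiv m : {c : ℕ // Squarefree c ∧ ∀ ℓ ∈ c.primeFactors,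
        Zhang2014.IsKolyvaginPrime (W.conductorNorm ℤ) W K p ℓ} → ℕ∞)
    (hmdiv : ∀ c (u : ℕ), (u : ℕ∞) ≤ mdiv c ↔ ∀ d : KolyvaginHeegnerData Dt β ι c.1,
      ∃ Q : (W.baseChange (ringClassField K ι c.1)).toAffine.Point,
        ((p ^ u : ℕ) : ℤ) • Q = d.derivedPoint)
    (hm : ∀ c, m c = if mdiv c < Zhang2014.levelIndex W p c.1 then mdiv c else ⊤)
    (c : {c : ℕ // Squarefree c ∧ ∀ ℓ ∈ c.primeFactors,
        Zhang2014.IsKolyvaginPrime (W.conductorNorm ℤ) W K p ℓ})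
    (mInf k : ℕ) (hmc : m c = mInf) (hik : mInf < k)
    (hkc : (k : ℕ∞) ≤ Zhang2014.levelIndex W p c.1) :
    ∃ d : KolyvaginHeegnerData Dt β ι c.1,
      (∃ Q : (W.baseChange (ringClassField K ι c.1)).toAffine.Point,
        ((p ^ mInf : ℕ) : ℤ) • Q = d.derivedPoint) ∧
      (¬ ∃ Q : (W.baseChange (ringClassField K ι c.1)).toAffine.Point,
        ((p ^ (mInf + 1) : ℕ) : ℤ) • Q = d.derivedPoint) ∧
      addOrderOf (d.kolyvaginClass (Fact.out : p.Prime) k) = p ^ (k - mInf) ∧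
      d.kolyvaginClass (Fact.out : p.Prime) k ≠ 0 := by
  have hp : p.Prime := Fact.out
  obtain ⟨-, -, d, hdvd, hndvd⟩ := exists_datum_exactDepth_of_m_eq Dt β ι mdiv m hmdiv hm c mInf hmc
  have hND : IsCoprime (W.conductorNorm ℤ : ℤ) (NumberField.discr K) :=
    KolyvaginAssembly.isCoprime_discr_of_satisfiesHeegnerHypothesis hK hH
  have hD : NumberField.discr K < -4 := KolyvaginAssembly.discr_lt_neg_four hK ⟨hD3, hD4⟩
  have hkol : ∀ q ∈ c.1.primeFactors, Zhang2014.IsKolyvaginPrime (W.conductorNorm ℤ) W K p q ∧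
      k ≤ Zhang2014.kolyvaginIndex W p q := fun q hq ↦
    ⟨c.2.2 q hq, Zhang2014.natCast_le_levelIndex_iff.mp hkc q hq⟩
  have hinert : ∀ (m' : ℕ), m' ∣ c.1 → ∀ q ∈ m'.primeFactors, (Ideal.span {(q : 𝓞 K)}).IsPrime :=
    fun m' hm' q hq ↦ (c.2.2 q (Nat.primeFactors_mono hm' c.2.1.ne_zero hq)).2.2.2.2.1
  -- data at every divisor of `c` (the given `d` at `c` itself)
  have hne : ∀ m' : ℕ, m' ∣ c.1 → Nonempty (KolyvaginHeegnerData Dt β ι m') := fun m' hm' ↦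
    BirchSwinnertonDyer.Theorems.nonempty_kolyvaginHeegnerData_of_grossCM hCM1 hCM2 hK hH Dt β ι
      d.dvd_sq_sub (c.2.1.squarefree_of_dvd hm') (hinert m' hm')
  let data : (m' : ℕ) → m' ∣ c.1 → KolyvaginHeegnerData Dt β ι m' := fun m' hm' ↦
    if h : m' = c.1 then h ▸ d else (hne m' hm').some
  have hdata : data c.1 dvd_rfl = d := by simp [data]
  have hord : addOrderOf (d.kolyvaginClass hp k) = p ^ (k - mInf) := by
    have h := addOrderOf_kolyvaginClass_of_exactDepth _ hp hik.le
      (isAdmissible_of_irreducible_of_split hK hp hp2 hirr hHp c.2.1 hkol data c.1 dvd_rfl)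
      (KolyCert.toGeomPoints_derivedPoint_mem_invPoints_of_dvd_zhang hK ι Dt hp hND hD c.2.1 hkol data c.1
        dvd_rfl)
      (by rw [hdata]; exact hdvd) (by rw [hdata]; exact hndvd)
    rwa [hdata] at h
  exact ⟨d, hdvd, hndvd, hord, McCallum1991.kolyvaginClass_ne_zero_of_addOrderOf_eq hp hik hord⟩

/-! ### §2 The sign `hκsign` on an irreducible row — UNCONDITIONAL (Gross Prop. 5.3 at the divisors of `c` is a tree theorem) -/

/-- **Gross 1991 Prop. 5.4 (1) for the concrete class on an IRREDUCIBLE row, UNCONDITIONAL**: for `E/ℚ` globally minimal,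
`K` imaginary quadratic with `d_K ∉ {−3, −4}` and the Heegner hypothesis for `N = N_E`, an odd prime `p` SPLIT in `K` with `E[p]`
irreducible, the non-trivial `τ ∈ Aut(K/ℚ)`, a frame `(Dt, β, ι)`, a square-free conductor `c` all of whose prime factors are
Kolyvagin primes of index `≥ k ≥ 1`, and ANY datum `d` of conductor `c`: `τ_* c_k(c) = e • c_k(c)` with
`e = −w(E)·(−1)^{#primes of c} ∈ {±1}` — bsd-potss k9-c4's `JetchevIrreducibleReadingSign.sign_conjAct_kolyvaginClass_of_irreducible`
with `p ∣ N_E` ↦ `p` split: x11b3's `conjAct_kolyvaginClass_eq_sign_smul_zhang` at `ε = −w(E)` with `h53` discharged by `JET.exists_mem_ringClassGal_isOfFinAddOrder_conj_sub_smul` at every divisor of `c` and the two CM facts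
by their `_holds` theorems. [cite: GrossLMS1991, §5 Prop. 5.3, Prop. 5.4 (1) (p. 243)] [cite: Jetchev2008, §4.1.3 (ε(c))] -/
theorem sign_conjAct_kolyvaginClass_of_irreducible_of_split [W.IsElliptic] [W.IsGloballyMinimal] [NeZero (W.conductorNorm ℤ)]
    (hK : IsImaginaryQuadratic K) (hD3 : NumberField.discr K ≠ -3) (hD4 : NumberField.discr K ≠ -4)
    (hH : SatisfiesHeegnerHypothesis (W.conductorNorm ℤ) K)
    {p : ℕ} [Fact p.Prime] (hp2 : p ≠ 2) (hirr : W.HasIrreducibleModPGaloisRep p)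
    (hHp : SatisfiesHeegnerHypothesis p K)
    (τ : K ≃ₐ[ℚ] K) (hτ : τ ≠ 1)
    (Dt : ModularParametrizationData W (W.conductorNorm ℤ)) (β : ℤ) (ι : K →+* ℂ)
    {c : ℕ} (hc : Squarefree c) {k : ℕ} (hk : 1 ≤ k)
    (hcK : ∀ ℓ ∈ c.primeFactors, Zhang2014.IsKolyvaginPrime (W.conductorNorm ℤ) W K p ℓ ∧
      k ≤ Zhang2014.kolyvaginIndex W p ℓ)
    (d : KolyvaginHeegnerData Dt β ι c) :
    (-W.rootNumber * (-1) ^ c.primeFactors.card = 1 ∨ -W.rootNumber * (-1) ^ c.primeFactors.card = -1) ∧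
      conjAct W τ ((p ^ k : ℕ) : ℤ) (d.kolyvaginClass (Fact.out : p.Prime) k) =
        (-W.rootNumber * (-1) ^ c.primeFactors.card) • d.kolyvaginClass (Fact.out : p.Prime) k := by
  have hp : p.Prime := Fact.out
  have hCM1 : phi_heegnerPointOfConductor_mem_range_map_ringClassField (W.conductorNorm ℤ) W K :=
    phi_heegnerPointOfConductor_mem_range_map_ringClassField_holds (W.conductorNorm ℤ) W K
  have hCM2 : exists_generator_ringClassGalOver K := exists_generator_ringClassGalOver_holds
  have hND : IsCoprime (W.conductorNorm ℤ : ℤ) (NumberField.discr K) :=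
    KolyvaginAssembly.isCoprime_discr_of_satisfiesHeegnerHypothesis hK hH
  have hD : NumberField.discr K < -4 := KolyvaginAssembly.discr_lt_neg_four hK ⟨hD3, hD4⟩
  have hinert : ∀ (m' : ℕ), m' ∣ c → ∀ q ∈ m'.primeFactors, (Ideal.span {(q : 𝓞 K)}).IsPrime :=
    fun m' hm' q hq ↦ (hcK q (Nat.primeFactors_mono hm' hc.ne_zero hq)).1.2.2.2.2.1
  -- data at every divisor of `c` (the given `d` at `c` itself)
  have hne : ∀ m' : ℕ, m' ∣ c → Nonempty (KolyvaginHeegnerData Dt β ι m') := fun m' hm' ↦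
    BirchSwinnertonDyer.Theorems.nonempty_kolyvaginHeegnerData_of_grossCM hCM1 hCM2 hK hH Dt β ι
      d.dvd_sq_sub (hc.squarefree_of_dvd hm') (hinert m' hm')
  let data : (m' : ℕ) → m' ∣ c → KolyvaginHeegnerData Dt β ι m' := fun m' hm' ↦
    if h : m' = c then h ▸ d else (hne m' hm').some
  have hdata : data c dvd_rfl = d := by simp [data]
  -- Gross Prop. 5.3 at every divisor of `c` (all `≠ 0` and prime to `N`), UNCONDITIONALLY (p525846)
  have h53 : ∀ (m : ℕ) (hm : m ∣ c) (τm : ringClassField K ι m ≃ₐ[ℚ] ringClassField K ι m),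
      (∀ x : ringClassField K ι m, ((τm x : ringClassField K ι m) : ℂ) = starRingEnd ℂ x) →
      ∃ σ' ∈ ringClassGal ι m, IsOfFinAddOrder
        (pointGalHom W (ringClassField K ι m) τm (data m hm).y -
          (-W.rootNumber) • pointGalHom W (ringClassField K ι m) σ' (data m hm).y) := by
    intro m hm τm hτm
    obtain ⟨hm0, hmN⟩ := ne_zero_and_coprime_of_isKolyvaginPrime (K := K) (hc.squarefree_of_dvd hm)
      (fun q hq ↦ (hcK q (Nat.primeFactors_mono hm hc.ne_zero hq)).1)
    exact exists_mem_ringClassGal_isOfFinAddOrder_conj_sub_smul W hK hH Dt ι hm0 hmN (data m hm) τm hτm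
  refine ⟨?_, ?_⟩
  · rcases W.rootNumber_eq_one_or with h1 | h1 <;>
      rcases neg_one_pow_eq_or ℤ c.primeFactors.card with h | h <;> simp [h1, h]
  · have h := conjAct_kolyvaginClass_eq_sign_smul_zhang (c := τ) hK ι hp hk Dt hND hD hc hcK data hτ
      (-W.rootNumber) h53
      (fun m hm ↦ isAdmissible_of_irreducible_of_split hK hp
        hp2 hirr hHp hc hcK data m hm)
      c dvd_rfl
    rwa [hdata] at h

/-- **The same in the `∃ ε ∈ {±1}` output shape** (with `ε := −w(E)`) consumed by the kernel-inputs assembly (= potss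
`JetchevIrreducibleReadingSign.exists_sign_conjAct_kolyvaginClass_of_irreducible` with `p ∣ N_E` ↦ `p` split). [cite: GrossLMS1991, §5 Prop. 5.4 (1) (p. 243)] -/
theorem exists_sign_conjAct_kolyvaginClass_of_irreducible_of_split [W.IsElliptic] [W.IsGloballyMinimal] [NeZero (W.conductorNorm ℤ)]
    (hK : IsImaginaryQuadratic K) (hD3 : NumberField.discr K ≠ -3) (hD4 : NumberField.discr K ≠ -4)
    (hH : SatisfiesHeegnerHypothesis (W.conductorNorm ℤ) K)
    {p : ℕ} [Fact p.Prime] (hp2 : p ≠ 2) (hirr : W.HasIrreducibleModPGaloisRep p)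
    (hHp : SatisfiesHeegnerHypothesis p K)
    (τ : K ≃ₐ[ℚ] K) (hτ : τ ≠ 1)
    (Dt : ModularParametrizationData W (W.conductorNorm ℤ)) (β : ℤ) (ι : K →+* ℂ)
    {c : ℕ} (hc : Squarefree c) {k : ℕ} (hk : 1 ≤ k)
    (hcK : ∀ ℓ ∈ c.primeFactors, Zhang2014.IsKolyvaginPrime (W.conductorNorm ℤ) W K p ℓ ∧
      k ≤ Zhang2014.kolyvaginIndex W p ℓ)
    (d : KolyvaginHeegnerData Dt β ι c) :
    ∃ ε : ℤ, (ε = 1 ∨ ε = -1) ∧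
      (ε * (-1) ^ c.primeFactors.card = 1 ∨ ε * (-1) ^ c.primeFactors.card = -1) ∧
      conjAct W τ ((p ^ k : ℕ) : ℤ) (d.kolyvaginClass (Fact.out : p.Prime) k) =
        (ε * (-1) ^ c.primeFactors.card) • d.kolyvaginClass (Fact.out : p.Prime) k := by
  refine ⟨-W.rootNumber, ?_, sign_conjAct_kolyvaginClass_of_irreducible_of_split hK hD3 hD4 hH hp2 hirr hHp τ hτ Dt β ι
    hc hk hcK d⟩
  rcases W.rootNumber_eq_one_or with h | h <;> simp [h]

/-! ### §3 The Kummer part of `hκsel` (mod [GZ86 III (3.1)]) on an irreducible row -/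

/-- **`loc_v c_k(c) ∈ H¹_Kum(K_v, E[p^k])` at every place `v` NOT over a prime factor of `c`, for `E[p]`
IRREDUCIBLE, `p` SPLIT in `K`**: bsd-jet's `JET.localization_kolyvaginClass_mem_kummerSelmerStructure_of_GZ31` with the
admissibility from irreducibility; modulo `hGZ` = [GZ86 III (3.1)] in the receptacle form (at EVERY bad place,
those over `p` included — at an additive `v ∣ p` this is where the reading's `v ∣ p` step sits; its GZ-free
alternative «`p ∤ c_p` + Lang» is not used here), `hcop′` and the two Gross §3 CM facts.
[cite: GrossLMS1991, §6 Prop. 6.2 (1)] [cite: GrossZagier1986, III (3.1)] [cite: Jetchev2008, Prop. 4.6 (p. 820)] -/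
theorem localization_kolyvaginClass_mem_kummerSelmerStructure_of_GZ31_of_irreducible_of_split [W.IsElliptic]
    [W.IsGloballyMinimal] [NeZero (W.conductorNorm ℤ)]
    (hCM1 : phi_heegnerPointOfConductor_mem_range_map_ringClassField (W.conductorNorm ℤ) W K)
    (hCM2 : exists_generator_ringClassGalOver K)
    (hK : IsImaginaryQuadratic K) (hD3 : NumberField.discr K ≠ -3) (hD4 : NumberField.discr K ≠ -4)
    (hH : SatisfiesHeegnerHypothesis (W.conductorNorm ℤ) K)
    {p : ℕ} [Fact p.Prime] (hp2 : p ≠ 2) (hirr : W.HasIrreducibleModPGaloisRep p)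
    (hHp : SatisfiesHeegnerHypothesis p K)
    (Dt : ModularParametrizationData W (W.conductorNorm ℤ)) (β : ℤ) (ι : K →+* ℂ)
    {n' : ℤ} (hcop' : IsCoprime (p : ℤ) n')
    (hGZ : ∀ (m : ℕ) (dm : KolyvaginHeegnerData Dt β ι m)
      (γ : ringClassField K ι m ≃ₐ[ℚ] ringClassField K ι m), γ ∈ ringClassGal ι m →
      ∀ v : HeightOneSpectrum (𝓞 K), ¬ (W.baseChange K).HasGoodReductionAt v →
        n' • pointsMap (W.baseChange K) (v.adicCompletion K)
            (dm.toGeomPoints (pointGalHom W (ringClassField K ι m) γ dm.y)) ∈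
          E0Receptacle (W.baseChange K) v ∧
        ∀ (ℓ : ℕ), ℓ ∈ m.primeFactors → ∀ (dm' : KolyvaginHeegnerData Dt β ι (m / ℓ))
          (hle : ringClassField K ι (m / ℓ) ≤ ringClassField K ι m),
          n' • pointsMap (W.baseChange K) (v.adicCompletion K)
              (dm.toGeomPoints (pointGalHom W (ringClassField K ι m) γ
                (WeierstrassCurve.Affine.Point.map (W' := W)
                  ((RingClassField.inclusion ι hle).restrictScalars ℚ) dm'.y))) ∈
            E0Receptacle (W.baseChange K) v)
    {c : ℕ} (hc : Squarefree c) {k : ℕ}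
    (hcK : ∀ ℓ ∈ c.primeFactors, Zhang2014.IsKolyvaginPrime (W.conductorNorm ℤ) W K p ℓ ∧
      k ≤ Zhang2014.kolyvaginIndex W p ℓ)
    (d : KolyvaginHeegnerData Dt β ι c) [∀ j : ℕ, NumberField (ringClassField K ι j)]
    (v : Place K) (hv : ∀ ℓ ∈ c.primeFactors, ¬ Jetchev2008.PlaceOver K v ℓ) :
    galoisCohomology.localization ((W.baseChange K).torsionGaloisModule ((p ^ k : ℕ) : ℤ)) v 1
        (d.kolyvaginClass (Fact.out : p.Prime) k) ∈
      (W.baseChange K).kummerSelmerStructure ((p ^ k : ℕ) : ℤ) v := by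
  have hp : p.Prime := Fact.out
  rcases v with w | 𝔳
  · -- complex place: `H¹(ℂ, ·) = 0`
    haveI : IsTotallyComplex K := hK.2
    have hw : w.IsComplex := IsTotallyComplex.isComplex w
    have htop := GlobalDuality.addSubgroup_galoisCohomology_inl_eq_top_of_isComplex
      ((W.baseChange K).torsionGaloisModule ((p ^ k : ℕ) : ℤ)) hw
      ((W.baseChange K).kummerSelmerStructure ((p ^ k : ℕ) : ℤ) (Sum.inl w))
    rw [htop]
    exact AddSubgroup.mem_top _
  · -- finite place `𝔳 ∤ c`
    have hcv : (c : 𝓞 K) ∉ 𝔳.asIdeal := fun h ↦ by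
      obtain ⟨ℓ, hℓ, hℓv⟩ := exists_primeFactor_mem_of_natCast_mem hc 𝔳 h
      exact hv ℓ hℓ ⟨𝔳, rfl, hℓv⟩
    have hND : IsCoprime (W.conductorNorm ℤ : ℤ) (NumberField.discr K) :=
      KolyvaginAssembly.isCoprime_discr_of_satisfiesHeegnerHypothesis hK hH
    have hD : NumberField.discr K < -4 := KolyvaginAssembly.discr_lt_neg_four hK ⟨hD3, hD4⟩
    have hinert : ∀ (m' : ℕ), m' ∣ c → ∀ q ∈ m'.primeFactors, (Ideal.span {(q : 𝓞 K)}).IsPrime :=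
      fun m' hm' q hq ↦ (hcK q (Nat.primeFactors_mono hm' hc.ne_zero hq)).1.2.2.2.2.1
    -- data at every divisor of `c` (the given `d` at `c` itself)
    have hne : ∀ m' : ℕ, m' ∣ c → Nonempty (KolyvaginHeegnerData Dt β ι m') := fun m' hm' ↦
      BirchSwinnertonDyer.Theorems.nonempty_kolyvaginHeegnerData_of_grossCM hCM1 hCM2 hK hH Dt β ι
        d.dvd_sq_sub (hc.squarefree_of_dvd hm') (hinert m' hm')
    let data : (m' : ℕ) → m' ∣ c → KolyvaginHeegnerData Dt β ι m' := fun m' hm' ↦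
      if h : m' = c then h ▸ d else (hne m' hm').some
    have hdata : data c dvd_rfl = d := by simp [data]
    have hcop : IsCoprime ((p ^ k : ℕ) : ℤ) n' := by
      rw [Nat.cast_pow]; exact IsCoprime.pow_left hcop'
    have h := hloc_concrete_of_GZ31_zhang hK ι hp Dt hND hD hc hcK data hcop
      (fun m hm γ hγ v hbad ↦ ⟨(hGZ m (data m hm) γ hγ v hbad).1,
        fun ℓ hℓ hle ↦ (hGZ m (data m hm) γ hγ v hbad).2 ℓ hℓ _ hle⟩)
      (fun m hm ↦ isAdmissible_of_irreducible_of_split hK hp hp2 hirr hHp hc hcK data m hm)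
      c dvd_rfl 𝔳 hcv
    rw [hdata] at h
    rw [← AddSubgroup.mem_comap, (W.baseChange K).comap_localization_kummerSelmerStructure]
    exact h

end Summit.BirchSwinnertonDyer.Rank1Residual.JET.Split

end
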